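import Mathlib
import Summits.Ventures.CertifiedArithmetic.LowPrec.OptTwoCandidates

/-!
# Opt / R4 — Theorem S5 (L∞ half): the non-clipping ("ceil") amax rule is minimax-optimal among power-of-two scales; Corollary S6-inf (E2M1, E2M3, E3M2)

HONEST FRAMING: certified error envelopes and provably optimal rounding/accumulation schemes for
low-precision formats under stated cost models; every table by two implementations; no hardware or
vendor claims.

For the one comparison not settled by Theorem S3 — the non-clipping scale against its half — the
adversary argument of OPTIMA.md Theorem S5: for every block `x` with maximum `a` there is a block `x'`
with the SAME maximum whose L∞ error at the half scale is at least the L∞ error of `x` at the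
non-clipping scale. Here `u` denotes the scale parameter of the HALF (clipping) candidate, so the
non-clipping grid is `(2u) • B` (top `2 T u ≥ a`) and the clipping grid is `u • B` (top `T u < a`).
The witness block: elements `≥ T u` are replaced by `a` (they cost at most `y - T u ≤ a - T u`, the clipping
error of `a`), elements in the coincidence zone `[L u, T u]` are kept (equal errors, Lemma S2(iii)), and
elements below `L u` (error `≤ u`, the coarse covering radius there) are replaced by a fixed point `w u`
of the zone at which the fine grid has error `≥ u`. Format data (decided by `decide`):
E2M1 `T=12, L=4, w=10`; E2M3 `T=60, L=16, w=58`; E3M2 `T=448, L=8, w=416`.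

THEOREM S5, L∞ (`ceil_vs_half`, generic; `ceil_vs_half_e2m1/_e2m3/_e3m2`, `ceil_minimax_e2m1/_e2m3/_e3m2`):
among amax-only rules the non-clipping rule is MINIMAX-optimal over all power-of-two scales (coarser and
finer-by-`≥ 2` scales are settled by Theorem S3 of `OptTwoCandidates.lean`; the half scale by the explicit
adversarial block above). COROLLARY S6-inf (`err_coarse_le_add`, `blockErr_coarse_le_add`,
`search_gain_le_e2m1/_e2m3/_e3m2`): no power-of-two scale beats the non-clipping scale by more than `u`
(half its finest spacing) in block L∞ error. Proofs: OPTIMA.md Theorem S5 / Corollary S6-inf (opt seat,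
pub-lowprec); constants two ways (code/opt/linf_gain_check.py).
-/

namespace Summit.Ventures.CertifiedArithmetic.LowPrec.Opt

section CeilMinimax

variable {K : Type*} [Field K] [LinearOrder K] [IsStrictOrderedRing K]
variable {B : Finset ℕ} (hB : B.Nonempty)

/-- a grid point within absolute distance `r` of `y` bounds the error by `r` -/
theorem err_le_of_near_abs {s y r : K} {n : ℕ} (hn : n ∈ B) (h1 : s * (n : K) - r ≤ y)
    (h2 : y ≤ s * (n : K) + r) : err hB s y ≤ r := by
  refine (gridDist_le_of_mem (sgrid_nonempty hB s) (mem_sgrid hn)).trans ?_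
  rw [abs_le]; constructor <;> linarith

/-- above the fine clip point `T u` (a coarse grid point), the coarse error is at most `y - T u` -/
theorem err_coarse_le_sub {T Tm : ℕ} (hTm : Tm ∈ B) (hT2 : 2 * Tm = T) {u y : K}
    (hy : (T : K) * u ≤ y) : err hB (2 * u) y ≤ y - (T : K) * u := by
  refine (gridDist_le_of_mem (sgrid_nonempty hB (2 * u)) (mem_sgrid hTm)).trans ?_
  have e : 2 * u * (Tm : K) = (T : K) * u := by
    have : ((2 * Tm : ℕ) : K) = T := by rw [hT2]
    push_cast at this; linear_combination u * this
  rw [e, abs_of_nonneg (by linarith)]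

/-- on the coincidence zone `[L u, T u]` the two grids give equal errors (Lemma S2(iii), scaled) -/
theorem err_coarse_eq_of_zone {T Tm L Lm : ℕ} (hT : T ∈ B) (hTm : Tm ∈ B) (hT2 : 2 * Tm = T)
    (hL : L ∈ B) (hLm : Lm ∈ B) (hL2 : 2 * Lm = L)
    (hAB : ∀ n ∈ B, L ≤ 2 * n → 2 * n ≤ T → 2 * n ∈ B)
    (hBA : ∀ n ∈ B, L ≤ n → n ≤ T → ∃ m ∈ B, 2 * m = n) {u y : K} (hu : 0 < u)
    (hly : (L : K) * u ≤ y) (hyT : y ≤ (T : K) * u) : err hB (2 * u) y = err hB u y := by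
  unfold err
  have cm : ∀ {m n : ℕ}, 2 * m = n → 2 * u * (m : K) = u * (n : K) := by
    intro m n h
    have : ((2 * m : ℕ) : K) = n := by rw [h]
    push_cast at this; linear_combination u * this
  refine gridDist_eq_of_coincide (sgrid_nonempty hB (2 * u)) (sgrid_nonempty hB u)
    (l := (L : K) * u) (c := (T : K) * u) ?_ ?_ ?_ ?_ hly hyT ?_ ?_
  · have := mem_sgrid (B := B) (s := 2 * u) hLm; rw [cm hL2, mul_comm u (L : K)] at this; exact this
  · have := mem_sgrid (B := B) (s := 2 * u) hTm; rw [cm hT2, mul_comm u (T : K)] at this; exact this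
  · have := mem_sgrid (B := B) (s := u) hL; rw [mul_comm] at this; exact this
  · have := mem_sgrid (B := B) (s := u) hT; rw [mul_comm] at this; exact this
  · intro a ha h1 h2
    obtain ⟨n, hn, rfl⟩ := Finset.mem_image.mp ha
    have hLn : L ≤ 2 * n := by
      have : (L : K) ≤ 2 * n := by nlinarith
      exact_mod_cast this
    have hnT : 2 * n ≤ T := by
      have : (2 * n : K) ≤ T := by nlinarith
      exact_mod_cast this
    have := mem_sgrid (B := B) (s := u) (hAB n hn hLn hnT)
    have e : u * ((2 * n : ℕ) : K) = 2 * u * (n : K) := by push_cast; ring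
    rw [e] at this; exact this
  · intro b hb h1 h2
    obtain ⟨n, hn, rfl⟩ := Finset.mem_image.mp hb
    have hLn : L ≤ n := by
      have : (L : K) ≤ n := by nlinarith
      exact_mod_cast this
    have hnT : n ≤ T := by
      have : (n : K) ≤ T := by nlinarith
      exact_mod_cast this
    obtain ⟨m, hm, hmn⟩ := hBA n hn hLn hnT
    have := mem_sgrid (B := B) (s := 2 * u) hm
    rw [cm hmn] at this; exact this

/-- a point `w u` at integer distance `≥ 1` from every fine grid point has fine error `≥ u` -/
theorem le_err_of_far {w : ℕ} (hw : ∀ n ∈ B, w + 1 ≤ n ∨ n + 1 ≤ w) {u : K} (hu : 0 < u) :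
    u ≤ err hB u ((w : K) * u) := by
  unfold err gridDist
  apply Finset.le_inf'
  intro v hv
  obtain ⟨n, hn, rfl⟩ := Finset.mem_image.mp hv
  rcases hw n hn with h | h
  · have : (w : K) + 1 ≤ n := by exact_mod_cast h
    rw [abs_of_nonpos (by nlinarith)]; nlinarith
  · have : (n : K) + 1 ≤ w := by exact_mod_cast h
    rw [abs_of_nonneg (by nlinarith)]; nlinarith

/-- **Theorem S5, L∞, the `e = -1` comparison (generic).** For every block with maximum `a`,
`T u < a ≤ 2 T u`, there is a block with the same maximum (all elements in `[0, a]`) whose L∞ error at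
the clipping scale `u` is at least the L∞ error of the given block at the non-clipping scale `2u`. -/
theorem ceil_vs_half {T Tm L Lm w : ℕ} (hT : T ∈ B) (hle : ∀ n ∈ B, n ≤ T) (hTm : Tm ∈ B)
    (hT2 : 2 * Tm = T) (hL : L ∈ B) (hLm : Lm ∈ B) (hL2 : 2 * Lm = L)
    (hAB : ∀ n ∈ B, L ≤ 2 * n → 2 * n ≤ T → 2 * n ∈ B)
    (hBA : ∀ n ∈ B, L ≤ n → n ≤ T → ∃ m ∈ B, 2 * m = n)
    (hwT : w ≤ T) (hw : ∀ n ∈ B, w + 1 ≤ n ∨ n + 1 ≤ w)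
    (hlow : ∀ u y : K, 0 < u → 0 ≤ y → y ≤ (L : K) * u → err hB (2 * u) y ≤ u)
    {k : ℕ} (x : Fin k → K) {u a : K} (hu : 0 < u) (hx0 : ∀ i, 0 ≤ x i) (hxa : ∀ i, x i ≤ a)
    (ha' : (T : K) * u < a) (i₀ : Fin k) (hi₀ : x i₀ = a) :
    ∃ x' : Fin k → K, (∀ i, 0 ≤ x' i) ∧ (∀ i, x' i ≤ a) ∧ x' i₀ = a ∧
      blockErr hB (2 * u) x i₀ ≤ blockErr hB u x' i₀ := by
  classical
  have hT0 : (0 : K) ≤ T := Nat.cast_nonneg T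
  have hwu : (w : K) * u ≤ (T : K) * u := by
    have : (w : K) ≤ T := by exact_mod_cast hwT
    nlinarith
  let x' : Fin k → K := fun i =>
    if (T : K) * u ≤ x i then a else if (L : K) * u ≤ x i then x i else (w : K) * u
  have hterm : ∀ i, err hB (2 * u) (x i) ≤ err hB u (x' i) := by
    intro i
    by_cases h1 : (T : K) * u ≤ x i
    · have e : x' i = a := by simp [x', h1]
      rw [e]
      have := err_coarse_le_sub hB hTm hT2 (u := u) h1
      have h2 := sub_top_le_err hB hle hu.le a
      linarith [hxa i]
    by_cases h2 : (L : K) * u ≤ x i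
    · have e : x' i = x i := by simp [x', h1, h2]
      rw [e, err_coarse_eq_of_zone hB hT hTm hT2 hL hLm hL2 hAB hBA hu h2 (le_of_lt (lt_of_not_ge h1))]
    · have e : x' i = (w : K) * u := by simp [x', h1, h2]
      rw [e]
      exact (hlow u (x i) hu (hx0 i) (le_of_lt (lt_of_not_ge h2))).trans (le_err_of_far hB hw hu)
  refine ⟨x', ?_, ?_, ?_, ?_⟩
  · intro i
    show 0 ≤ (if (T : K) * u ≤ x i then a else if (L : K) * u ≤ x i then x i else (w : K) * u)
    split_ifs
    · linarith [hx0 i, hxa i]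
    · exact hx0 i
    · positivity
  · intro i
    show (if (T : K) * u ≤ x i then a else if (L : K) * u ≤ x i then x i else (w : K) * u) ≤ a
    split_ifs
    · exact le_rfl
    · exact hxa i
    · linarith
  · show (if (T : K) * u ≤ x i₀ then a else if (L : K) * u ≤ x i₀ then x i₀ else (w : K) * u) = a
    rw [if_pos (by rw [hi₀]; exact ha'.le)]
  · refine Finset.sup'_le _ _ (fun i _ => ?_)
    exact (hterm i).trans (Finset.le_sup' (fun i => err hB u (x' i)) (Finset.mem_univ i))

/-- **Corollary S6-inf, termwise (generic).** The half scale improves NO element by more than `u`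
(half the finest spacing of the non-clipping grid `(2u) • B`). -/
theorem err_coarse_le_add {T Tm L Lm : ℕ} (hT : T ∈ B) (hle : ∀ n ∈ B, n ≤ T) (hTm : Tm ∈ B)
    (hT2 : 2 * Tm = T) (hL : L ∈ B) (hLm : Lm ∈ B) (hL2 : 2 * Lm = L)
    (hAB : ∀ n ∈ B, L ≤ 2 * n → 2 * n ≤ T → 2 * n ∈ B)
    (hBA : ∀ n ∈ B, L ≤ n → n ≤ T → ∃ m ∈ B, 2 * m = n)
    (hlow : ∀ u y : K, 0 < u → 0 ≤ y → y ≤ (L : K) * u → err hB (2 * u) y ≤ u)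
    {u y : K} (hu : 0 < u) (hy0 : 0 ≤ y) : err hB (2 * u) y ≤ err hB u y + u := by
  by_cases h1 : (T : K) * u ≤ y
  · have := err_coarse_le_sub hB hTm hT2 (u := u) h1
    have h2 := sub_top_le_err hB hle hu.le y
    linarith
  by_cases h2 : (L : K) * u ≤ y
  · rw [err_coarse_eq_of_zone hB hT hTm hT2 hL hLm hL2 hAB hBA hu h2 (le_of_lt (lt_of_not_ge h1))]
    linarith
  · have h0 : 0 ≤ err hB u y := gridDist_nonneg _ _
    linarith [hlow u y hu hy0 (le_of_lt (lt_of_not_ge h2))]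

/-- **Corollary S6-inf, block form (generic):** `blockErr (2u) x ≤ blockErr u x + u`. -/
theorem blockErr_coarse_le_add {T Tm L Lm : ℕ} (hT : T ∈ B) (hle : ∀ n ∈ B, n ≤ T) (hTm : Tm ∈ B)
    (hT2 : 2 * Tm = T) (hL : L ∈ B) (hLm : Lm ∈ B) (hL2 : 2 * Lm = L)
    (hAB : ∀ n ∈ B, L ≤ 2 * n → 2 * n ≤ T → 2 * n ∈ B)
    (hBA : ∀ n ∈ B, L ≤ n → n ≤ T → ∃ m ∈ B, 2 * m = n)
    (hlow : ∀ u y : K, 0 < u → 0 ≤ y → y ≤ (L : K) * u → err hB (2 * u) y ≤ u)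
    {k : ℕ} (x : Fin k → K) {u : K} (hu : 0 < u) (hx0 : ∀ i, 0 ≤ x i) (i₀ : Fin k) :
    blockErr hB (2 * u) x i₀ ≤ blockErr hB u x i₀ + u := by
  refine Finset.sup'_le _ _ (fun i _ => ?_)
  have hi : err hB u (x i) ≤ blockErr hB u x i₀ :=
    Finset.le_sup' (fun i => err hB u (x i)) (Finset.mem_univ i)
  linarith [err_coarse_le_add hB hT hle hTm hT2 hL hLm hL2 hAB hBA hlow hu (hx0 i) (y := x i)]

end CeilMinimax

section CeilMinimaxInstances

variable {K : Type*} [Field K] [LinearOrder K] [IsStrictOrderedRing K]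

/-- the coarse grid `(2u) • e2m1Lo` has covering radius `u` on the low zone `[0, 4 u]` -/
theorem e2m1_lowcov {u y : K} (hu : 0 < u) (hy0 : 0 ≤ y) (hy : y ≤ 4 * u) :
    err e2m1Lo_ne (2 * u) y ≤ u := by
  by_cases h0 : y ≤ 1 * u
  · exact err_le_of_near_abs e2m1Lo_ne (n := 0) (by decide) (by push_cast; linarith) (by push_cast; linarith)
  by_cases h1 : y ≤ 3 * u
  · exact err_le_of_near_abs e2m1Lo_ne (n := 1) (by decide) (by push_cast; linarith) (by push_cast; linarith)
  · exact err_le_of_near_abs e2m1Lo_ne (n := 2) (by decide) (by push_cast; linarith) (by push_cast; linarith)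

/-- the coarse grid `(2u) • e2m3Lo` has covering radius `u` on the low zone `[0, 16 u]` -/
theorem e2m3_lowcov {u y : K} (hu : 0 < u) (hy0 : 0 ≤ y) (hy : y ≤ 16 * u) :
    err e2m3Lo_ne (2 * u) y ≤ u := by
  by_cases h0 : y ≤ 1 * u
  · exact err_le_of_near_abs e2m3Lo_ne (n := 0) (by decide) (by push_cast; linarith) (by push_cast; linarith)
  by_cases h1 : y ≤ 3 * u
  · exact err_le_of_near_abs e2m3Lo_ne (n := 1) (by decide) (by push_cast; linarith) (by push_cast; linarith)
  by_cases h2 : y ≤ 5 * u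
  · exact err_le_of_near_abs e2m3Lo_ne (n := 2) (by decide) (by push_cast; linarith) (by push_cast; linarith)
  by_cases h3 : y ≤ 7 * u
  · exact err_le_of_near_abs e2m3Lo_ne (n := 3) (by decide) (by push_cast; linarith) (by push_cast; linarith)
  by_cases h4 : y ≤ 9 * u
  · exact err_le_of_near_abs e2m3Lo_ne (n := 4) (by decide) (by push_cast; linarith) (by push_cast; linarith)
  by_cases h5 : y ≤ 11 * u
  · exact err_le_of_near_abs e2m3Lo_ne (n := 5) (by decide) (by push_cast; linarith) (by push_cast; linarith)
  by_cases h6 : y ≤ 13 * u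
  · exact err_le_of_near_abs e2m3Lo_ne (n := 6) (by decide) (by push_cast; linarith) (by push_cast; linarith)
  by_cases h7 : y ≤ 15 * u
  · exact err_le_of_near_abs e2m3Lo_ne (n := 7) (by decide) (by push_cast; linarith) (by push_cast; linarith)
  · exact err_le_of_near_abs e2m3Lo_ne (n := 8) (by decide) (by push_cast; linarith) (by push_cast; linarith)

/-- the coarse grid `(2u) • e3m2Lo` has covering radius `u` on the low zone `[0, 8 u]` -/
theorem e3m2_lowcov {u y : K} (hu : 0 < u) (hy0 : 0 ≤ y) (hy : y ≤ 8 * u) :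
    err e3m2Lo_ne (2 * u) y ≤ u := by
  by_cases h0 : y ≤ 1 * u
  · exact err_le_of_near_abs e3m2Lo_ne (n := 0) (by decide) (by push_cast; linarith) (by push_cast; linarith)
  by_cases h1 : y ≤ 3 * u
  · exact err_le_of_near_abs e3m2Lo_ne (n := 1) (by decide) (by push_cast; linarith) (by push_cast; linarith)
  by_cases h2 : y ≤ 5 * u
  · exact err_le_of_near_abs e3m2Lo_ne (n := 2) (by decide) (by push_cast; linarith) (by push_cast; linarith)
  by_cases h3 : y ≤ 7 * u
  · exact err_le_of_near_abs e3m2Lo_ne (n := 3) (by decide) (by push_cast; linarith) (by push_cast; linarith)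
  · exact err_le_of_near_abs e3m2Lo_ne (n := 4) (by decide) (by push_cast; linarith) (by push_cast; linarith)

/-- **Theorem S5 (L∞, e = -1) for E2M1**: the clipping half scale is never minimax-better. -/
theorem ceil_vs_half_e2m1 {k : ℕ} (x : Fin k → K) {u a : K} (hu : 0 < u) (hx0 : ∀ i, 0 ≤ x i)
    (hxa : ∀ i, x i ≤ a) (ha' : ((12 : ℕ) : K) * u < a) (i₀ : Fin k) (hi₀ : x i₀ = a) :
    ∃ x' : Fin k → K, (∀ i, 0 ≤ x' i) ∧ (∀ i, x' i ≤ a) ∧ x' i₀ = a ∧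
      blockErr e2m1Lo_ne (2 * u) x i₀ ≤ blockErr e2m1Lo_ne u x' i₀ :=
  ceil_vs_half e2m1Lo_ne (T := 12) (Tm := 6) (L := 4) (Lm := 2) (w := 10) (by decide) (by decide) (by decide)
    (by norm_num) (by decide) (by decide) (by norm_num) (by decide) (by decide) (by norm_num) (by decide)
    (fun u y hu hy0 hy => e2m1_lowcov hu hy0 (by simpa using hy)) x hu hx0 hxa ha' i₀ hi₀

/-- **Theorem S5 (L∞, e = -1) for E2M3**: the clipping half scale is never minimax-better. -/
theorem ceil_vs_half_e2m3 {k : ℕ} (x : Fin k → K) {u a : K} (hu : 0 < u) (hx0 : ∀ i, 0 ≤ x i)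
    (hxa : ∀ i, x i ≤ a) (ha' : ((60 : ℕ) : K) * u < a) (i₀ : Fin k) (hi₀ : x i₀ = a) :
    ∃ x' : Fin k → K, (∀ i, 0 ≤ x' i) ∧ (∀ i, x' i ≤ a) ∧ x' i₀ = a ∧
      blockErr e2m3Lo_ne (2 * u) x i₀ ≤ blockErr e2m3Lo_ne u x' i₀ :=
  ceil_vs_half e2m3Lo_ne (T := 60) (Tm := 30) (L := 16) (Lm := 8) (w := 58) (by decide) (by decide) (by decide)
    (by norm_num) (by decide) (by decide) (by norm_num) (by decide) (by decide) (by norm_num) (by decide)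
    (fun u y hu hy0 hy => e2m3_lowcov hu hy0 (by simpa using hy)) x hu hx0 hxa ha' i₀ hi₀

/-- **Theorem S5 (L∞, e = -1) for E3M2**: the clipping half scale is never minimax-better. -/
theorem ceil_vs_half_e3m2 {k : ℕ} (x : Fin k → K) {u a : K} (hu : 0 < u) (hx0 : ∀ i, 0 ≤ x i)
    (hxa : ∀ i, x i ≤ a) (ha' : ((448 : ℕ) : K) * u < a) (i₀ : Fin k) (hi₀ : x i₀ = a) :
    ∃ x' : Fin k → K, (∀ i, 0 ≤ x' i) ∧ (∀ i, x' i ≤ a) ∧ x' i₀ = a ∧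
      blockErr e3m2Lo_ne (2 * u) x i₀ ≤ blockErr e3m2Lo_ne u x' i₀ :=
  ceil_vs_half e3m2Lo_ne (T := 448) (Tm := 224) (L := 8) (Lm := 4) (w := 416) (by decide) (by decide) (by decide)
    (by norm_num) (by decide) (by decide) (by norm_num) (by decide) (by decide) (by norm_num) (by decide)
    (fun u y hu hy0 hy => e3m2_lowcov hu hy0 (by simpa using hy)) x hu hx0 hxa ha' i₀ hi₀

/-- **Theorem S5 (L∞) for E2M1: the non-clipping power-of-two scale `2u` (`12 u < a ≤ 24 u`) is
minimax-optimal among ALL power-of-two scales `v`** — coarser-or-equal `v = 2^n (2u)`, the half `v = u`,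
or finer `v = (2u)/2^n`, `n ≥ 2`: every block is matched by a block with the same maximum doing at least
as badly at scale `v`. -/
theorem ceil_minimax_e2m1 {k : ℕ} (x : Fin k → K) {u a : K} (hu : 0 < u) (hx0 : ∀ i, 0 ≤ x i)
    (hxa : ∀ i, x i ≤ a) (ha : a ≤ ((12 : ℕ) : K) * (2 * u)) (ha' : ((12 : ℕ) : K) * u < a)
    (i₀ : Fin k) (hi₀ : x i₀ = a) (v : K)
    (hv : (∃ n : ℕ, v = 2 ^ n * (2 * u)) ∨ v = u ∨ (∃ n : ℕ, 2 ≤ n ∧ v = 2 * u / 2 ^ n)) :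
    ∃ x' : Fin k → K, (∀ i, 0 ≤ x' i) ∧ (∀ i, x' i ≤ a) ∧ x' i₀ = a ∧
      blockErr e2m1Lo_ne (2 * u) x i₀ ≤ blockErr e2m1Lo_ne v x' i₀ := by
  have h2u : 0 < 2 * u := by positivity
  have ha2 : ((12 : ℕ) : K) * (2 * u) < 2 * a := by linarith
  rcases hv with ⟨n, rfl⟩ | rfl | ⟨n, hn, rfl⟩
  · exact ⟨x, hx0, hxa, hi₀, (two_candidates_e2m1 x h2u hx0 hxa ha ha2 i₀ hi₀).1 n⟩
  · exact ceil_vs_half_e2m1 x hu hx0 hxa ha' i₀ hi₀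
  · exact ⟨x, hx0, hxa, hi₀, ((two_candidates_e2m1 x h2u hx0 hxa ha ha2 i₀ hi₀).2 n hn).le⟩

/-- **Theorem S5 (L∞) for E2M3: the non-clipping power-of-two scale `2u` (`60 u < a ≤ 120 u`) is
minimax-optimal among ALL power-of-two scales `v`** — coarser-or-equal `v = 2^n (2u)`, the half `v = u`,
or finer `v = (2u)/2^n`, `n ≥ 2`: every block is matched by a block with the same maximum doing at least
as badly at scale `v`. -/
theorem ceil_minimax_e2m3 {k : ℕ} (x : Fin k → K) {u a : K} (hu : 0 < u) (hx0 : ∀ i, 0 ≤ x i)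
    (hxa : ∀ i, x i ≤ a) (ha : a ≤ ((60 : ℕ) : K) * (2 * u)) (ha' : ((60 : ℕ) : K) * u < a)
    (i₀ : Fin k) (hi₀ : x i₀ = a) (v : K)
    (hv : (∃ n : ℕ, v = 2 ^ n * (2 * u)) ∨ v = u ∨ (∃ n : ℕ, 2 ≤ n ∧ v = 2 * u / 2 ^ n)) :
    ∃ x' : Fin k → K, (∀ i, 0 ≤ x' i) ∧ (∀ i, x' i ≤ a) ∧ x' i₀ = a ∧
      blockErr e2m3Lo_ne (2 * u) x i₀ ≤ blockErr e2m3Lo_ne v x' i₀ := by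
  have h2u : 0 < 2 * u := by positivity
  have ha2 : ((60 : ℕ) : K) * (2 * u) < 2 * a := by linarith
  rcases hv with ⟨n, rfl⟩ | rfl | ⟨n, hn, rfl⟩
  · exact ⟨x, hx0, hxa, hi₀, (two_candidates_e2m3 x h2u hx0 hxa ha ha2 i₀ hi₀).1 n⟩
  · exact ceil_vs_half_e2m3 x hu hx0 hxa ha' i₀ hi₀
  · exact ⟨x, hx0, hxa, hi₀, ((two_candidates_e2m3 x h2u hx0 hxa ha ha2 i₀ hi₀).2 n hn).le⟩

/-- **Theorem S5 (L∞) for E3M2: the non-clipping power-of-two scale `2u` (`448 u < a ≤ 896 u`) is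
minimax-optimal among ALL power-of-two scales `v`** — coarser-or-equal `v = 2^n (2u)`, the half `v = u`,
or finer `v = (2u)/2^n`, `n ≥ 2`: every block is matched by a block with the same maximum doing at least
as badly at scale `v`. -/
theorem ceil_minimax_e3m2 {k : ℕ} (x : Fin k → K) {u a : K} (hu : 0 < u) (hx0 : ∀ i, 0 ≤ x i)
    (hxa : ∀ i, x i ≤ a) (ha : a ≤ ((448 : ℕ) : K) * (2 * u)) (ha' : ((448 : ℕ) : K) * u < a)
    (i₀ : Fin k) (hi₀ : x i₀ = a) (v : K)
    (hv : (∃ n : ℕ, v = 2 ^ n * (2 * u)) ∨ v = u ∨ (∃ n : ℕ, 2 ≤ n ∧ v = 2 * u / 2 ^ n)) :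
    ∃ x' : Fin k → K, (∀ i, 0 ≤ x' i) ∧ (∀ i, x' i ≤ a) ∧ x' i₀ = a ∧
      blockErr e3m2Lo_ne (2 * u) x i₀ ≤ blockErr e3m2Lo_ne v x' i₀ := by
  have h2u : 0 < 2 * u := by positivity
  have ha2 : ((448 : ℕ) : K) * (2 * u) < 2 * a := by linarith
  rcases hv with ⟨n, rfl⟩ | rfl | ⟨n, hn, rfl⟩
  · exact ⟨x, hx0, hxa, hi₀, (two_candidates_e3m2 x h2u hx0 hxa ha ha2 i₀ hi₀).1 n⟩
  · exact ceil_vs_half_e3m2 x hu hx0 hxa ha' i₀ hi₀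
  · exact ⟨x, hx0, hxa, hi₀, ((two_candidates_e3m2 x h2u hx0 hxa ha ha2 i₀ hi₀).2 n hn).le⟩

/-- **Corollary S6-inf for E2M1: no power-of-two scale beats the non-clipping scale `2u` by more than
`u` in block L∞ error** (`u` = half the finest spacing of the non-clipping grid; the supremum `u` is
approached by blocks `(a, u)` with `a ↓ 12 u`, OPTIMA.md Corollary S6-inf). -/
theorem search_gain_le_e2m1 {k : ℕ} (x : Fin k → K) {u a : K} (hu : 0 < u) (hx0 : ∀ i, 0 ≤ x i)
    (hxa : ∀ i, x i ≤ a) (ha : a ≤ ((12 : ℕ) : K) * (2 * u)) (ha' : ((12 : ℕ) : K) * u < a)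
    (i₀ : Fin k) (hi₀ : x i₀ = a) (v : K)
    (hv : (∃ n : ℕ, v = 2 ^ n * (2 * u)) ∨ v = u ∨ (∃ n : ℕ, 2 ≤ n ∧ v = 2 * u / 2 ^ n)) :
    blockErr e2m1Lo_ne (2 * u) x i₀ ≤ blockErr e2m1Lo_ne v x i₀ + u := by
  have h2u : 0 < 2 * u := by positivity
  have ha2 : ((12 : ℕ) : K) * (2 * u) < 2 * a := by linarith
  rcases hv with ⟨n, rfl⟩ | rfl | ⟨n, hn, rfl⟩
  · linarith [(two_candidates_e2m1 x h2u hx0 hxa ha ha2 i₀ hi₀).1 n]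
  · exact blockErr_coarse_le_add e2m1Lo_ne (T := 12) (Tm := 6) (L := 4) (Lm := 2) (by decide) (by decide)
      (by decide) (by norm_num) (by decide) (by decide) (by norm_num) (by decide) (by decide)
      (fun u y hu hy0 hy => e2m1_lowcov hu hy0 (by simpa using hy)) x hu hx0 i₀
  · linarith [(two_candidates_e2m1 x h2u hx0 hxa ha ha2 i₀ hi₀).2 n hn]

/-- **Corollary S6-inf for E2M3: no power-of-two scale beats the non-clipping scale `2u` by more than
`u` in block L∞ error** (`u` = half the finest spacing of the non-clipping grid; the supremum `u` is
approached by blocks `(a, u)` with `a ↓ 60 u`, OPTIMA.md Corollary S6-inf). -/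
theorem search_gain_le_e2m3 {k : ℕ} (x : Fin k → K) {u a : K} (hu : 0 < u) (hx0 : ∀ i, 0 ≤ x i)
    (hxa : ∀ i, x i ≤ a) (ha : a ≤ ((60 : ℕ) : K) * (2 * u)) (ha' : ((60 : ℕ) : K) * u < a)
    (i₀ : Fin k) (hi₀ : x i₀ = a) (v : K)
    (hv : (∃ n : ℕ, v = 2 ^ n * (2 * u)) ∨ v = u ∨ (∃ n : ℕ, 2 ≤ n ∧ v = 2 * u / 2 ^ n)) :
    blockErr e2m3Lo_ne (2 * u) x i₀ ≤ blockErr e2m3Lo_ne v x i₀ + u := by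
  have h2u : 0 < 2 * u := by positivity
  have ha2 : ((60 : ℕ) : K) * (2 * u) < 2 * a := by linarith
  rcases hv with ⟨n, rfl⟩ | rfl | ⟨n, hn, rfl⟩
  · linarith [(two_candidates_e2m3 x h2u hx0 hxa ha ha2 i₀ hi₀).1 n]
  · exact blockErr_coarse_le_add e2m3Lo_ne (T := 60) (Tm := 30) (L := 16) (Lm := 8) (by decide) (by decide)
      (by decide) (by norm_num) (by decide) (by decide) (by norm_num) (by decide) (by decide)
      (fun u y hu hy0 hy => e2m3_lowcov hu hy0 (by simpa using hy)) x hu hx0 i₀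
  · linarith [(two_candidates_e2m3 x h2u hx0 hxa ha ha2 i₀ hi₀).2 n hn]

/-- **Corollary S6-inf for E3M2: no power-of-two scale beats the non-clipping scale `2u` by more than
`u` in block L∞ error** (`u` = half the finest spacing of the non-clipping grid; the supremum `u` is
approached by blocks `(a, u)` with `a ↓ 448 u`, OPTIMA.md Corollary S6-inf). -/
theorem search_gain_le_e3m2 {k : ℕ} (x : Fin k → K) {u a : K} (hu : 0 < u) (hx0 : ∀ i, 0 ≤ x i)
    (hxa : ∀ i, x i ≤ a) (ha : a ≤ ((448 : ℕ) : K) * (2 * u)) (ha' : ((448 : ℕ) : K) * u < a)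
    (i₀ : Fin k) (hi₀ : x i₀ = a) (v : K)
    (hv : (∃ n : ℕ, v = 2 ^ n * (2 * u)) ∨ v = u ∨ (∃ n : ℕ, 2 ≤ n ∧ v = 2 * u / 2 ^ n)) :
    blockErr e3m2Lo_ne (2 * u) x i₀ ≤ blockErr e3m2Lo_ne v x i₀ + u := by
  have h2u : 0 < 2 * u := by positivity
  have ha2 : ((448 : ℕ) : K) * (2 * u) < 2 * a := by linarith
  rcases hv with ⟨n, rfl⟩ | rfl | ⟨n, hn, rfl⟩
  · linarith [(two_candidates_e3m2 x h2u hx0 hxa ha ha2 i₀ hi₀).1 n]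
  · exact blockErr_coarse_le_add e3m2Lo_ne (T := 448) (Tm := 224) (L := 8) (Lm := 4) (by decide) (by decide)
      (by decide) (by norm_num) (by decide) (by decide) (by norm_num) (by decide) (by decide)
      (fun u y hu hy0 hy => e3m2_lowcov hu hy0 (by simpa using hy)) x hu hx0 i₀
  · linarith [(two_candidates_e3m2 x h2u hx0 hxa ha ha2 i₀ hi₀).2 n hn]

end CeilMinimaxInstances

end Summit.Ventures.CertifiedArithmetic.LowPrec.Opt
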